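import Mathlib
import Summits.Ventures.PercRepro.TriangleCapResidueStrict
import Summits.Ventures.PercRepro.TriangleCapDeepRows

/-!
# PercRepro — THE NECESSITY OF THE THRESHOLD `m ≥ D + r − 1` FOR `2 ≤ r ≤ D / 2`: BELOW IT THE RESIDUE MINIMUM IS
NOT ATTAINED (p3, gen 56; part 321)

For `2 ≤ r`, `2 r ≤ D`, `t = m D + r` and `m ≤ D + r − 2`, every graph of the band (triangle-free, `s` edges, `w` of
degree `s − t ≥ 1`, every off-degree `≤ D`) has `t (t − 1) + 2 r (D − 2 r + 1) + 2 ≤ 2 j + 2 t (D − 1)`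
(`else_bottom_strict_half`) — the residue bound of part 312 is strict there, while for `m ≥ D + r − 1` the star
family of part 319 attains it.  THE ARGUMENT: equality would force (deficiency identity of part 282, the strict
residue bounds of part 320) `I = r` inside edges, every row empty or full (hence exactly `m` full rows), at most one
partial column (of off-degree `2 r`); an inside edge `x x'` has disjoint rows (`nbrDeg x + nbrDeg x' ≤ m`,
`nbrDeg_add_nbrDeg_le_active`) and `inDeg x + inDeg x' ≤ I + 1` (`inDeg_add_inDeg_le_inside_succ`: the inside
edges at `x` or `x'` share only `x x'`), so `c(x) + c(x') ≤ m + r + 1` while `c(x) + c(x') ≥ D + 2 r` —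
`m ≥ D + r − 1`.  Axioms: standard.
-/

namespace PercRepro

namespace TriangleCap

namespace C047

open Finset

variable {V : Type*} [Fintype V] [DecidableEq V]

/-- A sum of values in `{0, D}` is `D` times the number of values equal to `D`. -/
theorem sum_eq_mul_card_of_zero_or {ι : Type*} [DecidableEq ι] (S : Finset ι) (c : ι → ℕ) (D : ℕ)
    (h : ∀ i ∈ S, c i = 0 ∨ c i = D) : ∑ i ∈ S, c i = D * (S.filter (fun i => c i = D)).card := by
  rw [← sum_filter_add_sum_filter_not S (fun i => c i = D),
    sum_const_nat (m := D) (fun i hi => (mem_filter.mp hi).2),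
    sum_eq_zero (fun i hi => by
      have h1 := h i (mem_filter.mp hi).1
      have h2 := (mem_filter.mp hi).2
      omega)]
  ring

/-- An inside edge joins two non-neighbours of `w`. -/
theorem exists_adj_nonNbrs (H : SimpleGraph V) [DecidableRel H.Adj] (w : V) (hI : 1 ≤ (insideEdges H w).card) :
    ∃ x ∈ nonNbrs H w, ∃ x' ∈ nonNbrs H w, H.Adj x x' := by
  obtain ⟨e, he⟩ := card_pos.mp hI
  rw [mem_insideEdges, mem_offEdges] at he
  revert he
  refine Sym2.ind (fun x x' he => ?_) e
  obtain ⟨⟨h1, h2⟩, h3⟩ := he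
  rw [SimpleGraph.mem_edgeFinset, SimpleGraph.mem_edgeSet] at h1
  refine ⟨x, ?_, x', ?_, h1⟩
  · rw [mem_nonNbrs]
    exact ⟨fun h => h2 (by rw [← h]; exact Sym2.mem_mk_left x x'), h3 x (Sym2.mem_mk_left x x')⟩
  · rw [mem_nonNbrs]
    exact ⟨fun h => h2 (by rw [← h]; exact Sym2.mem_mk_right x x'), h3 x' (Sym2.mem_mk_right x x')⟩

/-- **ADJACENT NON-NEIGHBOURS HAVE DISJOINT, ACTIVE ROWS:** `nbrDeg x + nbrDeg x' ≤ #{y ∈ N(w) : 1 ≤ c(y)}`. -/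
theorem nbrDeg_add_nbrDeg_le_active (H : SimpleGraph V) [DecidableRel H.Adj] (hfree : H.CliqueFree 3) (w x x' : V)
    (hx : x ∈ nonNbrs H w) (hx' : x' ∈ nonNbrs H w) (hxx' : H.Adj x x') :
    nbrDeg H w x + nbrDeg H w x' ≤ (univ.filter (fun y => H.Adj w y ∧ 1 ≤ offDeg H w y)).card := by
  unfold nbrDeg
  have hdisj : Disjoint (univ.filter (fun y => H.Adj w y ∧ H.Adj x y))
      (univ.filter (fun y => H.Adj w y ∧ H.Adj x' y)) := by
    rw [disjoint_left]
    intro y hy hy'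
    rw [mem_filter] at hy hy'
    exact no_triangle H hfree hxx' hy'.2.2 hy.2.2
  have hsub : univ.filter (fun y => H.Adj w y ∧ H.Adj x y) ∪ univ.filter (fun y => H.Adj w y ∧ H.Adj x' y) ⊆
      univ.filter (fun y => H.Adj w y ∧ 1 ≤ offDeg H w y) := by
    intro y hy
    rw [mem_union, mem_filter, mem_filter] at hy
    rw [mem_filter]
    rcases hy with hy | hy
    · refine ⟨mem_univ _, hy.2.1, ?_⟩
      rw [offDeg_nbr_eq_card H hfree w y hy.2.1]
      exact card_pos.mpr ⟨x, mem_filter.mpr ⟨hx, H.adj_symm hy.2.2⟩⟩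
    · refine ⟨mem_univ _, hy.2.1, ?_⟩
      rw [offDeg_nbr_eq_card H hfree w y hy.2.1]
      exact card_pos.mpr ⟨x', mem_filter.mpr ⟨hx', H.adj_symm hy.2.2⟩⟩
  have := card_le_card hsub
  rw [card_union_of_disjoint hdisj] at this
  exact this

/-- **THE INSIDE EDGES AT TWO ADJACENT NON-NEIGHBOURS:** `inDeg x + inDeg x' ≤ |inside| + 1` (they share `x x'`). -/
theorem inDeg_add_inDeg_le_inside_succ (H : SimpleGraph V) [DecidableRel H.Adj] (w x x' : V)
    (hx : x ∈ nonNbrs H w) (hx' : x' ∈ nonNbrs H w) (hxx' : H.Adj x x') :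
    inDeg H w x + inDeg H w x' ≤ (insideEdges H w).card + 1 := by
  unfold inDeg
  have hinj : ∀ u : V, Set.InjOn (fun z => s(u, z)) ↑((nonNbrs H w).filter (fun z => H.Adj u z)) := by
    intro u z _ z' _ h
    simp only at h
    rw [Sym2.eq_iff] at h
    rcases h with ⟨-, h⟩ | ⟨h1, h2⟩
    · exact h
    · rw [h2, h1]
  have hmem : ∀ u ∈ nonNbrs H w, ((nonNbrs H w).filter (fun z => H.Adj u z)).image (fun z => s(u, z)) ⊆
      insideEdges H w := by
    intro u hu e he
    rw [mem_image] at he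
    obtain ⟨z, hz, rfl⟩ := he
    rw [mem_filter, mem_nonNbrs] at hz
    rw [mem_insideEdges, mem_offEdges_iff_adj H w u z ((mem_nonNbrs H w u).mp hu).1 hz.1.1]
    refine ⟨hz.2, fun v hv => ?_⟩
    rw [Sym2.mem_iff] at hv
    rcases hv with rfl | rfl
    · exact ((mem_nonNbrs H w v).mp hu).2
    · exact hz.1.2
  have hAB := union_subset (hmem x hx) (hmem x' hx')
  have hinter : ((nonNbrs H w).filter (fun z => H.Adj x z)).image (fun z => s(x, z)) ∩
      ((nonNbrs H w).filter (fun z => H.Adj x' z)).image (fun z => s(x', z)) ⊆ {s(x, x')} := by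
    intro e he
    rw [mem_inter, mem_image, mem_image] at he
    obtain ⟨⟨z, -, rfl⟩, ⟨z', -, he⟩⟩ := he
    rw [mem_singleton]
    rw [Sym2.eq_iff] at he
    rcases he with ⟨h1, -⟩ | ⟨h1, -⟩
    · exact absurd (h1 ▸ hxx') H.irrefl
    · rw [Sym2.eq_iff]
      exact Or.inl ⟨rfl, h1.symm⟩
  have hu := card_union_add_card_inter (((nonNbrs H w).filter (fun z => H.Adj x z)).image (fun z => s(x, z)))
    (((nonNbrs H w).filter (fun z => H.Adj x' z)).image (fun z => s(x', z)))
  have h1 := card_le_card hAB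
  have h2 := card_le_card hinter
  rw [card_singleton] at h2
  rw [card_image_of_injOn (hinj x), card_image_of_injOn (hinj x')] at hu
  omega

/-- **THE RESIDUE MINIMUM IS NOT ATTAINED BELOW THE THRESHOLD:** for `2 ≤ r`, `2 r ≤ D`, `t = m D + r`,
`m ≤ D + r − 2`, every triangle-free `H` with `s` edges, `w` of degree `s − t ≥ 1`, every off-degree `≤ D`, at the band
value `2 j` has `t (t − 1) + 2 r (D − 2 r + 1) + 2 ≤ 2 j + 2 t (D − 1)`. -/
theorem else_bottom_strict_half (H : SimpleGraph V) [DecidableRel H.Adj] (hfree : H.CliqueFree 3) (s m r D j : ℕ)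
    (hr : 2 ≤ r) (h2 : 2 * r ≤ D) (hm : m + 2 ≤ D + r) (hs : H.edgeFinset.card = s) (w : V)
    (hw : deg H w + (m * D + r) = s) (hw1 : 1 ≤ deg H w)
    (hj : ∑ v, deg H v * deg H v + 2 * ((m * D + r) * (s - (m * D + r) - 1)) + 2 * j = s * (s + 1))
    (hD : ∀ v, offDeg H w v ≤ D) :
    (m * D + r) * (m * D + r - 1) + 2 * (r * (D - 2 * r + 1)) + 2 ≤ 2 * j + 2 * ((m * D + r) * (D - 1)) := by
  set t := m * D + r with ht
  have hD0 : 0 < D := by omega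
  have hmod : t % D = r := by
    rw [ht, Nat.add_comm, Nat.add_mul_mod_self_right, Nat.mod_eq_of_lt (by omega)]
  have hdef := deficiency_identity_split H hfree s t j D hs w hw hw1 hj hD
  have hoff : (offEdges H w).card = t := by
    have := card_offEdges_add_deg H w
    omega
  have hatt := attach_add_card_inside H hfree w
  rw [hoff] at hatt
  have hsumcol := sum_offDeg_nonNbrs_eq_add_card_inside H hfree w
  rw [hoff] at hsumcol
  have hsumrow : ∑ y ∈ univ.filter (fun y => H.Adj w y), offDeg H w y = t - (insideEdges H w).card := by
    unfold attach at hatt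
    omega
  have hIt : (insideEdges H w).card ≤ t := by omega
  have hcol := sum_mul_sub_ge_phi (nonNbrs H w) (offDeg H w) D (fun x _ => hD x)
  have hrow := sum_mul_sub_ge_phi (univ.filter (fun y => H.Adj w y)) (offDeg H w) D (fun y _ => hD y)
  rw [hsumcol] at hcol
  rw [hsumrow] at hrow
  by_contra hcon
  rw [not_le] at hcon
  by_cases hIr : (insideEdges H w).card = r
  swap
  · have := residue_strict_half D t (insideEdges H w).card hD0 hIt (by rw [hmod]; exact hr)
      (by rw [hmod]; exact h2) (by rw [hmod]; exact hIr)
    rw [hmod] at this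
    omega
  rw [hIr] at hdef hcol hrow hsumcol hsumrow
  have hphi1 : phiD D (t + r) = 2 * r * (D - 2 * r) := by
    rw [phiD_mod, Nat.add_mod, hmod, Nat.mod_eq_of_lt (by omega : r < D), ← two_mul, ← phiD_mod,
      phiD_two_mul_of_le D r h2]
  have hphi2 : phiD D (t - r) = 0 := by
    have e : t - r = D * m := by
      rw [ht, Nat.add_sub_cancel, Nat.mul_comm]
    rw [e, phiD_mod, Nat.mul_mod_right]
    unfold phiD
    simp
  rw [hphi1] at hcol
  rw [hphi2] at hrow
  have htarget : 2 * (r * (D - 2 * r + 1)) = 2 * r + 2 * r * (D - 2 * r) := by ring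
  -- the slack of the two φ-bounds is at most `1`
  have hslack : ∑ x ∈ nonNbrs H w, offDeg H w x * (D - offDeg H w x) +
      ∑ y ∈ univ.filter (fun y => H.Adj w y), offDeg H w y * (D - offDeg H w y) ≤ 2 * r * (D - 2 * r) + 1 := by
    omega
  -- every row is empty or full
  have hrows : ∀ y ∈ univ.filter (fun y => H.Adj w y), offDeg H w y = 0 ∨ offDeg H w y = D := by
    intro y hy
    have hle := hD y
    have hterm : offDeg H w y * (D - offDeg H w y) ≤ 1 := by
      have := single_le_sum (f := fun y => offDeg H w y * (D - offDeg H w y)) (fun _ _ => Nat.zero_le _) hy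
      omega
    by_contra hne
    rw [not_or] at hne
    obtain ⟨c', hc'⟩ : ∃ c', offDeg H w y = c' + 1 := ⟨offDeg H w y - 1, by omega⟩
    obtain ⟨d', hd'⟩ : ∃ d', D - offDeg H w y = d' + 1 := ⟨D - offDeg H w y - 1, by omega⟩
    rw [hd', hc'] at hterm
    have hDe : D = c' + d' + 2 := by omega
    have e : (c' + 1) * (d' + 1) = c' * d' + c' + d' + 1 := by ring
    rw [e] at hterm
    omega
  -- exactly `m` full rows, hence `m` active rows
  have hfull : (univ.filter (fun y => H.Adj w y ∧ offDeg H w y = D)).card = m := by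
    have hsum := sum_eq_mul_card_of_zero_or (univ.filter (fun y => H.Adj w y)) (offDeg H w) D hrows
    rw [hsumrow, filter_filter] at hsum
    have e : t - r = D * m := by
      rw [ht, Nat.add_sub_cancel, Nat.mul_comm]
    rw [e] at hsum
    exact (Nat.eq_of_mul_eq_mul_left hD0 hsum).symm
  have hactive : (univ.filter (fun y => H.Adj w y ∧ 1 ≤ offDeg H w y)).card = m := by
    rw [← hfull]
    congr 1
    apply filter_congr
    intro y _
    constructor
    · rintro ⟨h1, h1'⟩
      refine ⟨h1, ?_⟩
      rcases hrows y (mem_filter.mpr ⟨mem_univ _, h1⟩) with h | h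
      · omega
      · exact h
    · rintro ⟨h1, h1'⟩
      exact ⟨h1, by omega⟩
  -- at most one partial column
  have hone : ∀ x ∈ nonNbrs H w, ∀ x' ∈ nonNbrs H w, x ≠ x' → 1 ≤ offDeg H w x → offDeg H w x < D →
      1 ≤ offDeg H w x' → offDeg H w x' < D → False := by
    intro x hx x' hx' hne hx1 hx2 hx'1 hx'2
    have := sum_mul_sub_ge_phi_add_two (nonNbrs H w) (offDeg H w) D (fun z _ => hD z) x x' hx hx' hne hx1 hx2
      hx'1 hx'2
    rw [hsumcol, hphi1] at this
    omega
  -- a partial column has off-degree `2 r`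
  have hval : ∀ x₀ ∈ nonNbrs H w, 1 ≤ offDeg H w x₀ → offDeg H w x₀ < D → offDeg H w x₀ = 2 * r := by
    intro x₀ hx₀ h1 h2'
    have hothers : ∀ z ∈ (nonNbrs H w).erase x₀, offDeg H w z = 0 ∨ offDeg H w z = D := by
      intro z hz
      rw [mem_erase] at hz
      by_contra hne
      rw [not_or] at hne
      exact hone x₀ hx₀ z hz.2 (Ne.symm hz.1) h1 h2' (by omega) (by have := hD z; omega)
    have hsum := sum_eq_mul_card_of_zero_or ((nonNbrs H w).erase x₀) (offDeg H w) D hothers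
    have hsplit := sum_erase_add (nonNbrs H w) (offDeg H w) hx₀
    rw [hsumcol, hsum] at hsplit
    obtain ⟨F, hF⟩ : ∃ F, D * F + offDeg H w x₀ = t + r := ⟨_, hsplit⟩
    have hm' : (D * F + offDeg H w x₀) % D = (t + r) % D := by rw [hF]
    rw [Nat.mul_add_mod, Nat.mod_eq_of_lt h2', Nat.add_mod, hmod, Nat.mod_eq_of_lt (by omega : r < D),
      ← two_mul] at hm'
    rcases Nat.lt_or_ge (2 * r) D with hlt | hge
    · rw [Nat.mod_eq_of_lt hlt] at hm'
      exact hm'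
    · have : 2 * r = D := by omega
      rw [this, Nat.mod_self] at hm'
      omega
  -- the inside edge `x x'`
  obtain ⟨x, hx, x', hx', hxx'⟩ := exists_adj_nonNbrs H w (by omega)
  have hnb := nbrDeg_add_nbrDeg_le_active H hfree w x x' hx hx' hxx'
  rw [hactive] at hnb
  have hin := inDeg_add_inDeg_le_inside_succ H w x x' hx hx' hxx'
  rw [hIr] at hin
  have hcx := offDeg_eq_nbrDeg_add_inDeg H w x hx
  have hcx' := offDeg_eq_nbrDeg_add_inDeg H w x' hx'
  have hin1 : 1 ≤ inDeg H w x := by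
    unfold inDeg
    exact card_pos.mpr ⟨x', mem_filter.mpr ⟨hx', hxx'⟩⟩
  have hin1' : 1 ≤ inDeg H w x' := by
    unfold inDeg
    exact card_pos.mpr ⟨x, mem_filter.mpr ⟨hx, H.adj_symm hxx'⟩⟩
  have hDx := hD x
  have hDx' := hD x'
  by_cases hxD : offDeg H w x = D
  · by_cases hx'D : offDeg H w x' = D
    · omega
    · have := hval x' hx' (by omega) (by omega)
      omega
  · by_cases hx'D : offDeg H w x' = D
    · have := hval x hx (by omega) (by omega)
      omega
    · exact hone x hx x' hx' (H.ne_of_adj hxx') (by omega) (by omega) (by omega) (by omega)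

end C047

end TriangleCap

end PercRepro
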